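import Literature.MathematicalPhysics.QuantumFieldTheory.Balaban1983to89.B6RandomWalkInputNorm
import Literature.MathematicalPhysics.QuantumFieldTheory.Balaban1983to89.B6Prop26RightChainGeneric

/-!
# `Balaban1983to89.B6RandomWalkInputNormChain` — T. Bałaban, *Propagators and renormalization transformations for lattice gauge theories. II*,
# Commun. Math. Phys. **96** (1984) 223–250 [Balaban1984PropagatorsII], Prop. 2.6 (2.138)/(2.139) with (2.141) p. 247 and (2.64)–(2.66) p. 234:
# *"Reasoning in the same way as in the proof of Proposition 2.2"* FOR THE MIXED sup/Hölder-INPUT NORMS — gluing, Lemma 2.1 with any constant, the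
# fixed-point step `T = T₀ + S·T₁` and the mirror (left fixed point) route, on the admissible-input majorants of `…B6RandomWalkInputNorm` (file 2 of 2)

statement-level skeleton of published theorems with citation tags; proofs where landed; nothing here is a claim about the Yang–Mills mass gap

PDF held: `paper:balaban1984-cmp96-propagators-rt-ii` (journal page = PDF page + 222); p. 247 [PDF 25] (×2 render re-read, see file 1), pp. 232–234
[PDF 10–12] ((2.52)–(2.55), Lemma 2.1 (2.61)–(2.63), (2.64)–(2.66)), p. 239 [PDF 17] ((2.91)–(2.93)) as quoted in `…B6RandomWalk` / `…B6Prop26Gluing`.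
WHAT IS PRINTED (p. 247, after (2.135)): *"Reasoning in the same way as in the proof of Proposition 2.2 we obtain Proposition 2.6"* with its entries
(2.138) `|(∇G∇*J)(x)| ≤ O(1)e^{−δ₃d(y,y′)}(‖J‖^{ξ′}_ε + |J|)` and (2.139) `‖ζ∇G∇*J‖_α ≤ O(1)(Lʲη)^{−α}(‖ζ‖^ξ_α + |ζ|)e^{−δ₃d(y,y′)}(‖J‖^{ξ′}_{α+ε} + |J|)`,
and *"G = G₀(I − R)⁻¹ = Σ_{n=0}^∞ G₀Rⁿ = … (2.141) and the series above is convergent in the norms appearing in the inequalities (2.136)–(2.140)."*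

CITATION HEADER (lean-in-tree rule) — WHAT IS REPRODUCED.  Phase-2 file of the `lit-balaban` typed skeleton (HOME `run/shared/lean/pub/lit-balaban/`),
seat **p27 gen 90** (free-target protocol G.5-34(d), TAKING HOME/STATUS 2026-08-24T15:44Z, cc the B6 fold owner r03 and the natural owners p38/p22 of
the k-level slots); SKELETON rows **B6.Eq2.138** × **B6.Eq2.139** × B6.Prop2.6 × B6.Eq2.141 × B6.Eq2.64–2.66 (cells only; decls of record untouched).
THE READING (continued from file 1).  Through the fixed point `G = G₀ + GR` of (2.91)/(2.141) (`…B6Prop26.fixedPoint_of_291`) the entry (2.138) is ONE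
composition and ONE sum, `∇G∇* = ∇G₀∇* + (∇G)·(R∇*)`, with the sup majorant of `∇G` = (2.136)₂ already a theorem of the walk (for (2.139):
`ζ∇G∇* = ζ∇G₀∇* + (ζ∇G)·(R∇*)` with (2.137)₁); alternatively, by p38's transposed walk (`…B6Prop26RightChainGeneric`: `G·D′ = G₀D′ + R̃·(G·D′)`,
`R̃ = Rᵀ`) it is a LEFT fixed point for `G∇*` on Hölder inputs followed by the sup letter `∇R̃`.  Both readings are made available here for the
admissible-input majorants `HasMajorantA blk adm T K` of `…B6RandomWalkInputNorm`:
* §1 localisation and gluing — the `…B6Prop26Gluing` twins: `hasMajorantA_localise_out/_in/_localise` (indicators `1_S(y)`, `1_{S′}(y′)`),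
  `inKill_mul_mulOp` (a right cut-off `h_{□′}` seen only from the regions of `S′` kills the admissible inputs localised off `S′`),
  **`hasMajorantA_sum_overlap`** / **`hasMajorantA_sum_pairs_overlap`** (*"G₀ = Σ_□ …"*, *"R = Σ_{□,□′} …"*: overlap `N` ⇒ constants `N`, `N²`);
* §2 (2.63) with two factors and ANY (2.61)-constant `c` (`…B6Lemma21Repaired.Ineq263With c`, the form the k-level files bind):
  `conv_two_le_of_ineq263With`, `conv_two_weighted_le` (prefactors `P(y)` of the OUTPUT block and `Q(y′)` of the INPUT block ride through);
* §3 THE (2.138)/(2.139)-SHAPE STEP: the algebra `conj_fixedPoint` (`G = G₀ + GR` ⟹ `D·G·D′ = D·G₀·D′ + (D·G)·(R·D′)`; the one-sided cases are the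
  tree's `…B6Prop26Norms.right_mul_fixedPoint` / `…B6Prop26.left_mul_fixedPoint`, not restated),
  `hasMajorantA_affine` (`T = T₀ + S·T₁`), and **`prop26_chain_2138With`**: `T₀ ≺_adm A₀P(y)Q(y′)e^{−δd}`, `S ≺ A_S P(y)e^{−δd}` (sup),
  `T₁ ≺_adm θQ(y′)e^{−δd}` ⟹ `T ≺_adm (A₀ + A_Sθc²)·P(y)Q(y′)·e^{−(1−α)δd(y,y′)}` — no iteration on the admissible side, no smallness at this step
  (the smallness `θc₁ < 1` of Prop. 2.6 is spent once, in the sup majorant of `S = ∇G` resp. `ζ∇G`);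
* §4 THE MIRROR ROUTE: the left chain on the admissible side `majorant_leftIterA` (`R̃ⁿT₀ ≺_adm A(θc)ⁿe^{−(1−α)δd(a,b)}P(b)` from
  `T₀ ≺_adm Ae^{−δd(a,b)}P(b)`, `R̃ ≺ θe^{−δd}`, (2.54), (2.61) with ANY constant `c` — `Ineq261With`), `majorant_leftPartialSumA` (`θc < 1`),
  **`majorant_of_leftFixedPointA`** (any `T = T₀ + R̃T` on a finite lattice has `T ≺_adm A(1 − θc)⁻¹e^{−(1−α)δd(a,b)}P(b)`, the remainder dying by p38's
  `sup_pow_le` once the class sizes dominate the sup of the input) — p38's `majorant_leftIterW` / `majorant_leftPartialSumW` / `majorant_of_leftFixedPointW`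
  with the composition `hasMajorant_mul_hasMajorantA` of file 1 in place of `hasMajorant_mul`.
THEOREMS ONLY; no `def`, no `def … : Prop` fact, no new hypothesis-shaped statement; standard axioms.  Imports file 1 and `…B6Prop26RightChainGeneric`
(which carries `…B6Prop26ChainGeneric`, `…B6Lemma21Repaired`, `…B6RandomWalkHom`; all long built).

HONEST SCOPE / DIVERGENCES.  (1) As file 1: bookkeeping only — the k-level last legs on Hölder inputs, the window transplant, the census readings are NOT
here (B6-CLOSURE §5 item 21).  (2) Print sums the series (2.141); as in `…B6Prop26` / `…B6RandomWalk.majorant_of_fixedPoint_266` the fixed-point forms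
are used; §3 needs no limit on the admissible side, §4 lets `N → ∞` exactly as p38's sup version.  (3) Lemma 2.1 enters only through (2.61)/(2.63) with
an ARBITRARY constant `c` and the triangle inequality (2.54) — the printed `c₁(α)` is refuted as typed (cell GAPS G-A11-1); consumers bind the realised
row sums.  NOT summit progress.  Unit `lit-balaban-p27` (gen 90), 2026-08-24.
-/

noncomputable section

open scoped BigOperators
open Finset

namespace Literature.MathematicalPhysics.QuantumFieldTheory.Balaban1983to89.B6RandomWalkInputNormChain

open B6RandomWalk (BlockSupp HasMajorant blockPiece sum_blockPiece blockSupp_blockPiece chain chain_zero chain_succ)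
open B6Prop26Gluing (mulOp mulOp_apply ind ind_nonneg ind_of_mem ind_of_not_mem sum_ind_eq_card OutLoc)
open B6Lemma21Repaired (Ineq263With)
open B6RandomWalkInputNorm (HasMajorantA hasMajorantA_mono hasMajorantA_add hasMajorantA_finsetSum hasMajorant_mul_hasMajorantA)

variable {g : B6.Geometry} {X : Type}

/-! ## §1  Localisation to the reach of a box and bounded-overlap gluing (the `B6Prop26Gluing` twins) -/

section Gluing

variable (blk : X → g.Site) {adm : (X → ℝ) → g.Site → ℝ → Prop}

/-- A majorant `K` of an operator localised in OUTPUT to `S` (`B6Prop26Gluing.OutLoc`: the left cut-offs of (2.92)–(2.93)) improves to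
`1_S(y)·K(y,y′)`. [cite: Balaban1984PropagatorsII, (2.92)–(2.93) p.239, bookkeeping] -/
theorem hasMajorantA_localise_out {T : Module.End ℝ (X → ℝ)} {K : g.Site → g.Site → ℝ} {S : Set g.Site}
    (hT : HasMajorantA blk adm T K) (hout : OutLoc blk T S) :
    HasMajorantA blk adm T (fun a b => ind S a * K a b) := by
  intro y' μ B hμ x
  beta_reduce
  by_cases hx : blk x ∈ S
  · rw [ind_of_mem hx, one_mul]
    exact hT y' μ B hμ x
  · rw [hout μ x hx, abs_zero, ind_of_not_mem hx, zero_mul, zero_mul]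

/-- A majorant of an operator killing every admissible input localised off `S′` improves to `1_{S′}(y′)·K(y,y′)` (the right cut-off `h_{□′}` of
`K_{□,□′}G_{□′}h_{□′}`). [cite: Balaban1984PropagatorsII, (2.91) p.239, bookkeeping] -/
theorem hasMajorantA_localise_in {T : Module.End ℝ (X → ℝ)} {K : g.Site → g.Site → ℝ} {S' : Set g.Site}
    (hT : HasMajorantA blk adm T K)
    (hin : ∀ (y' : g.Site) (μ : X → ℝ) (B : ℝ), adm μ y' B → y' ∉ S' → T μ = 0) :
    HasMajorantA blk adm T (fun a b => ind S' b * K a b) := by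
  intro y' μ B hμ x
  beta_reduce
  by_cases hy : y' ∈ S'
  · rw [ind_of_mem hy, one_mul]
    exact hT y' μ B hμ x
  · rw [hin y' μ B hμ hy, Pi.zero_apply, abs_zero, ind_of_not_mem hy, zero_mul, zero_mul]

/-- Both localisations at once: `1_S(y)·1_{S′}(y′)·K(y,y′)`. [cite: Balaban1984PropagatorsII, (2.91)–(2.93) p.239, bookkeeping] -/
theorem hasMajorantA_localise {T : Module.End ℝ (X → ℝ)} {K : g.Site → g.Site → ℝ} {S S' : Set g.Site}
    (hT : HasMajorantA blk adm T K) (hout : OutLoc blk T S)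
    (hin : ∀ (y' : g.Site) (μ : X → ℝ) (B : ℝ), adm μ y' B → y' ∉ S' → T μ = 0) :
    HasMajorantA blk adm T (fun a b => ind S a * ind S' b * K a b) := by
  have h := hasMajorantA_localise_out blk (hasMajorantA_localise_in blk hT hin) hout
  refine fun y' μ B hμ x => (h y' μ B hμ x).trans_eq ?_
  simp only [mul_assoc, mul_left_comm (ind S' y')]

/-- A multiplication factor `h` supported over blocks that only the input regions of sites in `S′` can see kills every input localised (in the sense of
the region map `R`) at a site `y′ ∉ S′`. [cite: Balaban1984PropagatorsII, (2.91) p.239, bookkeeping] -/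
theorem mulOp_eq_zero_of_region {R : g.Site → Set g.Site} {h μ : X → ℝ} {S' : Set g.Site} {y' : g.Site}
    (hμ : ∀ x, μ x ≠ 0 → blk x ∈ R y') (hh : ∀ x, h x ≠ 0 → ∀ y'', blk x ∈ R y'' → y'' ∈ S') (hy' : y' ∉ S') :
    mulOp h μ = 0 := by
  funext x
  rw [mulOp_apply, Pi.zero_apply]
  by_cases hμx : μ x = 0
  · rw [hμx, mul_zero]
  · have hhx : h x = 0 := by
      by_contra hne
      exact hy' (hh x hne y' (hμ x hμx))
    rw [hhx, zero_mul]

/-- **Input localisation by a right cut-off**: if every admissible input at `y′` is supported over the blocks of `R y′` and `h` is seen only from the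
regions of sites of `S′`, then `T·h` kills the admissible inputs localised off `S′` (the hypothesis `hin` of `hasMajorantA_localise_in`).
[cite: Balaban1984PropagatorsII, (2.91) p.239, bookkeeping] -/
theorem inKill_mul_mulOp {R : g.Site → Set g.Site} {h : X → ℝ} {S' : Set g.Site} (T : Module.End ℝ (X → ℝ))
    (hsuppA : ∀ (μ : X → ℝ) (y' : g.Site) (B : ℝ), adm μ y' B → ∀ x, μ x ≠ 0 → blk x ∈ R y')
    (hh : ∀ x, h x ≠ 0 → ∀ y'', blk x ∈ R y'' → y'' ∈ S') :
    ∀ (y' : g.Site) (μ : X → ℝ) (B : ℝ), adm μ y' B → y' ∉ S' → (T * mulOp h) μ = 0 := by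
  intro y' μ B hμ hy'
  rw [Module.End.mul_apply, mulOp_eq_zero_of_region blk (hsuppA μ y' B hμ) hh hy', map_zero]

open Classical in
/-- **Bounded-overlap gluing, single sum** (*"G₀ = Σ_□ h_□G_□h_□"* resp. `∇G₀∇* = Σ_□ ∇h_□G_□h_□∇*`): terms with majorants `1_{S_□}(y)·K(y,y′)`, a
common `K ≥ 0`, every block in at most `N` reach sets ⟹ the sum has the majorant `N·K`. [cite: Balaban1984PropagatorsII, (2.91) p.239 + (2.141) p.247, bookkeeping] -/
theorem hasMajorantA_sum_overlap {C : Type} (D : Finset C) (S : C → Set g.Site) (T : C → Module.End ℝ (X → ℝ))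
    (K : g.Site → g.Site → ℝ) (hK : ∀ a b, 0 ≤ K a b)
    (hadm : ∀ (μ : X → ℝ) (y' : g.Site) (B : ℝ), adm μ y' B → 0 ≤ B)
    (hT : ∀ c ∈ D, HasMajorantA blk adm (T c) (fun a b => ind (S c) a * K a b))
    (N : ℕ) (hN : ∀ a : g.Site, (D.filter fun c => a ∈ S c).card ≤ N) :
    HasMajorantA blk adm (∑ c ∈ D, T c) (fun a b => N * K a b) := by
  refine hasMajorantA_mono blk (hasMajorantA_finsetSum blk D T _ hT) hadm fun a b => ?_
  show ∑ c ∈ D, ind (S c) a * K a b ≤ N * K a b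
  rw [← Finset.sum_mul, sum_ind_eq_card]
  exact mul_le_mul_of_nonneg_right (by exact_mod_cast hN a) (hK a b)

open Classical in
/-- **Bounded-overlap gluing, double sum** (*"R = Σ_{□,□′} K_{□,□′}G_{□′}h_{□′}"*, here followed by `∇*` on Hölder inputs): terms with majorants
`1_{S_□}(y)·1_{S_□′}(y′)·K(y,y′)`, a common `K ≥ 0`, overlap `N` ⟹ the double sum has the majorant `N²·K`.
[cite: Balaban1984PropagatorsII, (2.91) p.239 + (2.134)–(2.135) p.247, bookkeeping] -/
theorem hasMajorantA_sum_pairs_overlap {C : Type} (D : Finset C) (S : C → Set g.Site)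
    (T : C → C → Module.End ℝ (X → ℝ)) (K : g.Site → g.Site → ℝ) (hK : ∀ a b, 0 ≤ K a b)
    (hadm : ∀ (μ : X → ℝ) (y' : g.Site) (B : ℝ), adm μ y' B → 0 ≤ B)
    (hT : ∀ c ∈ D, ∀ c' ∈ D, HasMajorantA blk adm (T c c') (fun a b => ind (S c) a * ind (S c') b * K a b))
    (N : ℕ) (hN : ∀ a : g.Site, (D.filter fun c => a ∈ S c).card ≤ N) :
    HasMajorantA blk adm (∑ c ∈ D, ∑ c' ∈ D, T c c') (fun a b => (N : ℝ) ^ 2 * K a b) := by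
  have hNa : ∀ a : g.Site, ∑ c ∈ D, ind (S c) a ≤ N := fun a => by
    rw [sum_ind_eq_card]
    exact_mod_cast hN a
  have hinner : ∀ c ∈ D,
      HasMajorantA blk adm (∑ c' ∈ D, T c c') (fun a b => ind (S c) a * ((N : ℝ) * K a b)) := by
    intro c hc
    refine hasMajorantA_mono blk (hasMajorantA_finsetSum blk D (T c) _ (hT c hc)) hadm fun a b => ?_
    show ∑ c' ∈ D, ind (S c) a * ind (S c') b * K a b ≤ ind (S c) a * ((N : ℝ) * K a b)
    have hre : ∑ c' ∈ D, ind (S c) a * ind (S c') b * K a b =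
        ind (S c) a * ((∑ c' ∈ D, ind (S c') b) * K a b) := by
      rw [Finset.sum_mul, Finset.mul_sum]
      exact Finset.sum_congr rfl fun c' _ => by ring
    rw [hre]
    exact mul_le_mul_of_nonneg_left (mul_le_mul_of_nonneg_right (hNa b) (hK a b)) (ind_nonneg _ _)
  refine hasMajorantA_mono blk (hasMajorantA_finsetSum blk D (fun c => ∑ c' ∈ D, T c c') _ hinner) hadm fun a b => ?_
  show ∑ c ∈ D, ind (S c) a * ((N : ℝ) * K a b) ≤ (N : ℝ) ^ 2 * K a b
  rw [← Finset.sum_mul]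
  calc (∑ c ∈ D, ind (S c) a) * ((N : ℝ) * K a b) ≤ (N : ℝ) * ((N : ℝ) * K a b) :=
        mul_le_mul_of_nonneg_right (hNa a) (mul_nonneg (Nat.cast_nonneg N) (hK a b))
    _ = (N : ℝ) ^ 2 * K a b := by ring

end Gluing

/-! ## §2  (2.63) with two factors and any (2.61)-constant -/

section Convolution

/-- **(2.63), n = 2, generic constant** (`m = 1` of `…B6Lemma21Repaired.Ineq263With c`): `Σ_{y″} e^{−δd(y,y″)}e^{−δd(y″,y′)} ≤ c²e^{−(1−α)δd(y,y′)}`.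
[cite: Balaban1984PropagatorsII, Lemma 2.1 (2.63) p.234] -/
theorem conv_two_le_of_ineq263With {c δ α : ℝ} (h : Ineq263With c g δ α) (y y' : g.Site) :
    ∑ y'' : g.Site, Real.exp (-(δ * g.dist y y'')) * Real.exp (-(δ * g.dist y'' y')) ≤
      c ^ 2 * Real.exp (-((1 - α) * δ * g.dist y y')) := by
  have h1 := h 1 y y'
  simpa [chain] using h1

/-- The same with a prefactor `A·P(y)` of the OUTPUT block on the first kernel and `θ·Q(y′)` of the INPUT block on the second (they ride through the
`y″`-sum): `Σ_{y″} A P(y)e^{−δd(y,y″)}·θQ(y′)e^{−δd(y″,y′)} ≤ Aθc²P(y)Q(y′)e^{−(1−α)δd(y,y′)}`. [cite: Balaban1984PropagatorsII, Lemma 2.1 (2.63) p.234 + (2.64)–(2.66) p.234, bookkeeping] -/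
theorem conv_two_weighted_le {c δ α A θ : ℝ} (P Q : g.Site → ℝ) (y y' : g.Site) (hA : 0 ≤ A) (hθ : 0 ≤ θ)
    (hP : 0 ≤ P y) (hQ : 0 ≤ Q y') (h : Ineq263With c g δ α) :
    ∑ y'' : g.Site, (A * P y * Real.exp (-(δ * g.dist y y''))) * (θ * Q y' * Real.exp (-(δ * g.dist y'' y'))) ≤
      A * θ * c ^ 2 * P y * Q y' * Real.exp (-((1 - α) * δ * g.dist y y')) := by
  have hc := conv_two_le_of_ineq263With h y y'
  have hw : 0 ≤ A * θ * P y * Q y' := mul_nonneg (mul_nonneg (mul_nonneg hA hθ) hP) hQ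
  calc ∑ y'' : g.Site, (A * P y * Real.exp (-(δ * g.dist y y''))) * (θ * Q y' * Real.exp (-(δ * g.dist y'' y')))
      = (A * θ * P y * Q y') * ∑ y'' : g.Site, Real.exp (-(δ * g.dist y y'')) * Real.exp (-(δ * g.dist y'' y')) := by
        rw [Finset.mul_sum]
        exact Finset.sum_congr rfl fun _ _ => by ring
    _ ≤ (A * θ * P y * Q y') * (c ^ 2 * Real.exp (-((1 - α) * δ * g.dist y y'))) := mul_le_mul_of_nonneg_left hc hw
    _ = A * θ * c ^ 2 * P y * Q y' * Real.exp (-((1 - α) * δ * g.dist y y')) := by ring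

end Convolution

/-! ## §3  The (2.138)/(2.139)-shape step through the fixed point of (2.91)/(2.141) -/

section Chain2138

variable (blk : X → g.Site) {adm : (X → ℝ) → g.Site → ℝ → Prop}

/-- **Both-sided factors ride along the fixed point**: `G = G₀ + GR` ((2.91) multiplied by `G = Δ_a⁻¹`, `…B6Prop26.fixedPoint_of_291`) gives, for every
left factor `D` and right factor `D′` (`D = ∇` or `ζ∇`, `D′ = ∇*` for (2.138)/(2.139)), `D·G·D′ = D·G₀·D′ + (D·G)·(R·D′)` (the right-factor case
`D = 1` is the tree's `…B6Prop26Norms.right_mul_fixedPoint`; the left-factor case `D′ = 1` is `…B6Prop26.left_mul_fixedPoint`).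
[cite: Balaban1984PropagatorsII, (2.91) p.239 + (2.141) p.247] -/
theorem conj_fixedPoint {G G0 R : Module.End ℝ (X → ℝ)} (D D' : Module.End ℝ (X → ℝ)) (hfix : G = G0 + G * R) :
    D * G * D' = D * G0 * D' + D * G * (R * D') := by
  conv_lhs => rw [hfix]
  simp only [mul_add, add_mul, mul_assoc]

/-- **The affine step**: `T = T₀ + S·T₁` with `T₀ ≺_adm K₀`, `S ≺ K_S` (sup), `T₁ ≺_adm K₁ ≥ 0` ⟹ `T ≺_adm K₀ + K_S ⋆ K₁` (§1 + §2).
[cite: Balaban1984PropagatorsII, (2.52) p.232 + (2.141) p.247] -/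
theorem hasMajorantA_affine {T T₀ S T₁ : Module.End ℝ (X → ℝ)} {K₀ KS K₁ : g.Site → g.Site → ℝ}
    (hfix : T = T₀ + S * T₁) (h₀ : HasMajorantA blk adm T₀ K₀) (hS : HasMajorant blk S KS)
    (h₁ : HasMajorantA blk adm T₁ K₁) (hK₁ : ∀ a b, 0 ≤ K₁ a b)
    (hadm : ∀ (μ : X → ℝ) (y' : g.Site) (B : ℝ), adm μ y' B → 0 ≤ B) :
    HasMajorantA blk adm T (fun a b => K₀ a b + ∑ y'' : g.Site, KS a y'' * K₁ y'' b) := by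
  rw [hfix]
  exact hasMajorantA_add blk h₀ (hasMajorant_mul_hasMajorantA blk hS h₁ hK₁ hadm)

/-- **"REASONING IN THE SAME WAY AS IN THE PROOF OF PROPOSITION 2.2", THE (2.138)/(2.139) SHAPE, KERNEL-CHECKED** (p. 247; the walk (2.141) read
through `T = T₀ + S·T₁`, e.g. `∇G∇* = ∇G₀∇* + (∇G)(R∇*)`): over a block geometry with (2.63) at rate `δ ≥ 0` and ANY (2.61)-constant `c`
(`Ineq263With c g δ α`, `0 ≤ α`, `d ≥ 0`), if the n = 0 term has `T₀ ≺_adm A₀·P(y)Q(y′)·e^{−δd(y,y′)}`, the sup letter `S ≺ A_S·P(y)·e^{−δd}`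
((2.136)₂ resp. (2.137)₁ with its output prefactor `P`) and the last legs `T₁ ≺_adm θ·Q(y′)·e^{−δd}` ((2.134) on the admissible inputs, input weight `Q`),
then `T ≺_adm (A₀ + A_Sθc²)·P(y)Q(y′)·e^{−(1−α)δd(y,y′)}` — the printed `O(1)e^{−δ₃d}(‖J‖^{ξ′}_ε + |J|)` shape with `δ₃ = (1−α)δ` and O(1) EXPLICIT; no
smallness is needed at this step (it was spent in the sup majorant of `S`). [cite: Balaban1984PropagatorsII, Prop. 2.6 (2.138)–(2.139), (2.141) p.247 + (2.64)–(2.66) p.234] -/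
theorem prop26_chain_2138With {T T₀ S T₁ : Module.End ℝ (X → ℝ)} (c δ α A₀ AS θ : ℝ) (P Q : g.Site → ℝ)
    (hA₀ : 0 ≤ A₀) (hAS : 0 ≤ AS) (hθ : 0 ≤ θ) (hP : ∀ a, 0 ≤ P a) (hQ : ∀ b, 0 ≤ Q b)
    (hδ : 0 ≤ δ) (hα : 0 ≤ α) (hdnn : ∀ a b : g.Site, 0 ≤ g.dist a b) (h263 : Ineq263With c g δ α)
    (hadm : ∀ (μ : X → ℝ) (y' : g.Site) (B : ℝ), adm μ y' B → 0 ≤ B)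
    (hfix : T = T₀ + S * T₁)
    (h₀ : HasMajorantA blk adm T₀ (fun a b => A₀ * P a * Q b * Real.exp (-(δ * g.dist a b))))
    (hS : HasMajorant blk S (fun a b => AS * P a * Real.exp (-(δ * g.dist a b))))
    (h₁ : HasMajorantA blk adm T₁ (fun a b => θ * Q b * Real.exp (-(δ * g.dist a b)))) :
    HasMajorantA blk adm T
      (fun a b => (A₀ + AS * θ * c ^ 2) * P a * Q b * Real.exp (-((1 - α) * δ * g.dist a b))) := by
  have hK₁ : ∀ a b : g.Site, 0 ≤ θ * Q b * Real.exp (-(δ * g.dist a b)) := fun a b =>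
    mul_nonneg (mul_nonneg hθ (hQ b)) (Real.exp_nonneg _)
  refine hasMajorantA_mono blk (hasMajorantA_affine blk hfix h₀ hS h₁ hK₁ hadm) hadm fun a b => ?_
  show A₀ * P a * Q b * Real.exp (-(δ * g.dist a b)) +
      ∑ y'' : g.Site, AS * P a * Real.exp (-(δ * g.dist a y'')) * (θ * Q b * Real.exp (-(δ * g.dist y'' b))) ≤
      (A₀ + AS * θ * c ^ 2) * P a * Q b * Real.exp (-((1 - α) * δ * g.dist a b))
  have hconv := conv_two_weighted_le (g := g) P Q a b hAS hθ (hP a) (hQ b) h263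
  have hrate : Real.exp (-(δ * g.dist a b)) ≤ Real.exp (-((1 - α) * δ * g.dist a b)) :=
    Real.exp_le_exp.mpr (neg_le_neg (mul_le_mul_of_nonneg_right (by nlinarith) (hdnn a b)))
  calc A₀ * P a * Q b * Real.exp (-(δ * g.dist a b)) +
        ∑ y'' : g.Site, AS * P a * Real.exp (-(δ * g.dist a y'')) * (θ * Q b * Real.exp (-(δ * g.dist y'' b)))
      ≤ A₀ * P a * Q b * Real.exp (-((1 - α) * δ * g.dist a b)) +
          AS * θ * c ^ 2 * P a * Q b * Real.exp (-((1 - α) * δ * g.dist a b)) :=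
        add_le_add (mul_le_mul_of_nonneg_left hrate (mul_nonneg (mul_nonneg hA₀ (hP a)) (hQ b))) hconv
    _ = (A₀ + AS * θ * c ^ 2) * P a * Q b * Real.exp (-((1 - α) * δ * g.dist a b)) := by ring

end Chain2138

/-! ## §4  The mirror route: the LEFT fixed point `T = T₀ + R̃T` on the admissible side (p38's `…B6Prop26RightChainGeneric` §2 for `HasMajorantA`) -/

section LeftChain

variable (blk : X → g.Site) {adm : (X → ℝ) → g.Site → ℝ → Prop}

/-- **THE LEFT CHAIN `R̃ⁿT₀` ON THE ADMISSIBLE SIDE**: if `T₀ ≺_adm A·e^{−δd(a,b)}·P(b)` (prefactor at the INPUT block) and the sup letter `R̃ ≺ θe^{−δd}`,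
then `R̃ⁿT₀ ≺_adm A(θc)ⁿ·e^{−(1−α)δd(a,b)}·P(b)` — p38's `…B6Prop26RightChainGeneric.majorant_leftIterW` with the composition of §2 in place of
`hasMajorant_mul` (induction with `R̃` in front; (2.54) and ONE use of (2.61) per step). For (2.138) by the transposed walk: `T₀ = G₀∇*` on Hölder inputs,
`R̃ = Rᵀ`. [cite: Balaban1984PropagatorsII, (2.64)–(2.66) p.234, (2.54) p.233, (2.61) p.234, (2.141) p.247] -/
theorem majorant_leftIterA (c δ α θ A : ℝ) (P : g.Site → ℝ) (hA : 0 ≤ A) (hP : ∀ y, 0 ≤ P y) (hθ : 0 ≤ θ) (hc : 0 ≤ c)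
    (hα0 : 0 ≤ α) (hα1 : α ≤ 1) (hδ : 0 ≤ δ) (htri : B6RandomWalk.Triangle254 g) (hdnn : ∀ a b : g.Site, 0 ≤ g.dist a b)
    (h261 : B6Lemma21Repaired.Ineq261With c g δ α)
    (hadm : ∀ (μ : X → ℝ) (y' : g.Site) (B : ℝ), adm μ y' B → 0 ≤ B)
    {T0 R : Module.End ℝ (X → ℝ)}
    (hT0 : HasMajorantA blk adm T0 (fun a b => A * Real.exp (-(δ * g.dist a b)) * P b))
    (hR : HasMajorant blk R (fun a b => θ * Real.exp (-(δ * g.dist a b)))) (n : ℕ) :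
    HasMajorantA blk adm (R ^ n * T0) (fun a b => A * (θ * c) ^ n * Real.exp (-((1 - α) * δ * g.dist a b)) * P b) := by
  induction n with
  | zero =>
      rw [pow_zero, one_mul]
      refine hasMajorantA_mono blk hT0 hadm fun a b => ?_
      rw [pow_zero, mul_one]
      refine mul_le_mul_of_nonneg_right (mul_le_mul_of_nonneg_left (Real.exp_le_exp.mpr (neg_le_neg ?_)) hA) (hP b)
      have := hdnn a b
      nlinarith [mul_nonneg (mul_nonneg hα0 hδ) this]
  | succ n ih =>
      rw [pow_succ', mul_assoc]
      have hK₂ : ∀ a b : g.Site, 0 ≤ A * (θ * c) ^ n * Real.exp (-((1 - α) * δ * g.dist a b)) * P b := fun a b =>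
        mul_nonneg (mul_nonneg (mul_nonneg hA (pow_nonneg (mul_nonneg hθ hc) n)) (Real.exp_nonneg _)) (hP b)
      refine hasMajorantA_mono blk (hasMajorant_mul_hasMajorantA blk hR ih hK₂ hadm) hadm fun a b => ?_
      have hterm : ∀ y'' : g.Site,
          θ * Real.exp (-(δ * g.dist a y'')) * (A * (θ * c) ^ n * Real.exp (-((1 - α) * δ * g.dist y'' b)) * P b) ≤
            A * (θ * c) ^ n * θ * P b * Real.exp (-((1 - α) * δ * g.dist a b)) * Real.exp (-(α * δ * g.dist a y'')) := by
        intro y''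
        have hexp : Real.exp (-(δ * g.dist a y'')) * Real.exp (-((1 - α) * δ * g.dist y'' b)) ≤
            Real.exp (-((1 - α) * δ * g.dist a b)) * Real.exp (-(α * δ * g.dist a y'')) := by
          rw [← Real.exp_add, ← Real.exp_add]
          refine Real.exp_le_exp.mpr ?_
          have key : (1 - α) * δ * g.dist a b ≤ (1 - α) * δ * (g.dist a y'' + g.dist y'' b) :=
            mul_le_mul_of_nonneg_left (htri a y'' b) (mul_nonneg (sub_nonneg.2 hα1) hδ)
          nlinarith [key]
        have h0 : 0 ≤ A * (θ * c) ^ n * θ * P b :=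
          mul_nonneg (mul_nonneg (mul_nonneg hA (pow_nonneg (mul_nonneg hθ hc) n)) hθ) (hP b)
        calc θ * Real.exp (-(δ * g.dist a y'')) * (A * (θ * c) ^ n * Real.exp (-((1 - α) * δ * g.dist y'' b)) * P b)
            = A * (θ * c) ^ n * θ * P b * (Real.exp (-(δ * g.dist a y'')) * Real.exp (-((1 - α) * δ * g.dist y'' b))) := by ring
          _ ≤ A * (θ * c) ^ n * θ * P b * (Real.exp (-((1 - α) * δ * g.dist a b)) * Real.exp (-(α * δ * g.dist a y''))) :=
              mul_le_mul_of_nonneg_left hexp h0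
          _ = _ := by ring
      have h0 : 0 ≤ A * (θ * c) ^ n * θ * P b * Real.exp (-((1 - α) * δ * g.dist a b)) :=
        mul_nonneg (mul_nonneg (mul_nonneg (mul_nonneg hA (pow_nonneg (mul_nonneg hθ hc) n)) hθ) (hP b)) (Real.exp_nonneg _)
      calc ∑ y'' : g.Site, θ * Real.exp (-(δ * g.dist a y'')) * (A * (θ * c) ^ n * Real.exp (-((1 - α) * δ * g.dist y'' b)) * P b)
          ≤ ∑ y'' : g.Site, A * (θ * c) ^ n * θ * P b * Real.exp (-((1 - α) * δ * g.dist a b)) * Real.exp (-(α * δ * g.dist a y'')) :=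
            Finset.sum_le_sum fun y'' _ => hterm y''
        _ = A * (θ * c) ^ n * θ * P b * Real.exp (-((1 - α) * δ * g.dist a b)) * ∑ y'' : g.Site, Real.exp (-(α * δ * g.dist a y'')) := by
            rw [Finset.mul_sum]
        _ ≤ A * (θ * c) ^ n * θ * P b * Real.exp (-((1 - α) * δ * g.dist a b)) * c := mul_le_mul_of_nonneg_left (h261 a) h0
        _ = A * (θ * c) ^ (n + 1) * Real.exp (-((1 - α) * δ * g.dist a b)) * P b := by ring

/-- the partial sums `Σ_{n<N} R̃ⁿT₀` of the left chain on the admissible side: majorant `A(1 − θc)⁻¹·e^{−(1−α)δd(a,b)}·P(b)` uniformly in `N`, under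
`θc < 1`. [cite: Balaban1984PropagatorsII, (2.66) p.234, (2.50) p.232, (2.141) p.247] -/
theorem majorant_leftPartialSumA (c δ α θ A : ℝ) (P : g.Site → ℝ) (hA : 0 ≤ A) (hP : ∀ y, 0 ≤ P y) (hθ : 0 ≤ θ) (hc : 0 ≤ c)
    (hα0 : 0 ≤ α) (hα1 : α ≤ 1) (hδ : 0 ≤ δ) (htri : B6RandomWalk.Triangle254 g) (hdnn : ∀ a b : g.Site, 0 ≤ g.dist a b)
    (h261 : B6Lemma21Repaired.Ineq261With c g δ α) (hsmall : θ * c < 1)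
    (hadm : ∀ (μ : X → ℝ) (y' : g.Site) (B : ℝ), adm μ y' B → 0 ≤ B)
    {T0 R : Module.End ℝ (X → ℝ)}
    (hT0 : HasMajorantA blk adm T0 (fun a b => A * Real.exp (-(δ * g.dist a b)) * P b))
    (hR : HasMajorant blk R (fun a b => θ * Real.exp (-(δ * g.dist a b)))) (N : ℕ) :
    HasMajorantA blk adm (∑ n ∈ Finset.range N, R ^ n * T0)
      (fun a b => A * (1 - θ * c)⁻¹ * Real.exp (-((1 - α) * δ * g.dist a b)) * P b) := by
  set q : ℝ := θ * c with hq
  have hq0 : 0 ≤ q := mul_nonneg hθ hc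
  have hterm : ∀ n ∈ Finset.range N,
      HasMajorantA blk adm (R ^ n * T0) (fun a b => A * q ^ n * Real.exp (-((1 - α) * δ * g.dist a b)) * P b) := fun n _ =>
    majorant_leftIterA blk c δ α θ A P hA hP hθ hc hα0 hα1 hδ htri hdnn h261 hadm hT0 hR n
  refine hasMajorantA_mono blk (hasMajorantA_finsetSum blk (Finset.range N) (fun n => R ^ n * T0) _ hterm) hadm fun a b => ?_
  show ∑ n ∈ Finset.range N, A * q ^ n * Real.exp (-((1 - α) * δ * g.dist a b)) * P b ≤
      A * (1 - q)⁻¹ * Real.exp (-((1 - α) * δ * g.dist a b)) * P b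
  have hgeom : ∑ n ∈ Finset.range N, q ^ n ≤ (1 - q)⁻¹ :=
    sum_le_hasSum (Finset.range N) (fun n _ => pow_nonneg hq0 n) (hasSum_geometric_of_lt_one hq0 hsmall)
  have hC : 0 ≤ A * Real.exp (-((1 - α) * δ * g.dist a b)) * P b := mul_nonneg (mul_nonneg hA (Real.exp_nonneg _)) (hP b)
  calc ∑ n ∈ Finset.range N, A * q ^ n * Real.exp (-((1 - α) * δ * g.dist a b)) * P b
      = A * Real.exp (-((1 - α) * δ * g.dist a b)) * P b * ∑ n ∈ Finset.range N, q ^ n := by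
        rw [Finset.mul_sum]; refine Finset.sum_congr rfl fun n _ => ?_; ring
    _ ≤ A * Real.exp (-((1 - α) * δ * g.dist a b)) * P b * (1 - q)⁻¹ := mul_le_mul_of_nonneg_left hgeom hC
    _ = _ := by ring

/-- **THE LEFT FIXED POINT ON THE ADMISSIBLE SIDE** (the mirror route of p38's `majorant_of_leftFixedPointW`, for (2.138) read as `G∇* = G₀∇* + R̃(G∇*)`
on Hölder inputs): on a finite lattice, any `T` with `T = T₀ + R̃T`, `T₀ ≺_adm A·e^{−δd(a,b)}·P(b)`, `R̃ ≺ θe^{−δd}` (sup), `θc < 1`, over a class whose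
sizes dominate the sup of the input (`adm μ y′ B ⟹ |μ| ≤ B`, so that the remainder `R̃ᴺT` of the telescope dies: `‖R̃ᴺ‖_∞ ≤ (θc)ᴺ`,
`…B6Prop26RightChainGeneric.sup_pow_le`, `…B6RandomWalk.exists_opBound`), has `T ≺_adm A(1 − θc)⁻¹·e^{−(1−α)δd(a,b)}·P(b)`.
[cite: Balaban1984PropagatorsII, Prop. 2.2 (2.66)–(2.67) p.234, Prop. 2.6 (2.138) + (2.141) p.247] -/
theorem majorant_of_leftFixedPointA [Fintype X] [DecidableEq X] (c δ α θ A : ℝ) (P : g.Site → ℝ) (hA : 0 ≤ A) (hP : ∀ y, 0 ≤ P y)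
    (hθ : 0 ≤ θ) (hc : 0 ≤ c) (hα0 : 0 ≤ α) (hα1 : α ≤ 1) (hδ : 0 ≤ δ) (htri : B6RandomWalk.Triangle254 g)
    (hdnn : ∀ a b : g.Site, 0 ≤ g.dist a b) (h261 : B6Lemma21Repaired.Ineq261With c g δ α) (hsmall : θ * c < 1)
    (hadm : ∀ (μ : X → ℝ) (y' : g.Site) (B : ℝ), adm μ y' B → 0 ≤ B)
    (hsup : ∀ (μ : X → ℝ) (y' : g.Site) (B : ℝ), adm μ y' B → ∀ x, |μ x| ≤ B)
    {T T0 R : Module.End ℝ (X → ℝ)}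
    (hT0 : HasMajorantA blk adm T0 (fun a b => A * Real.exp (-(δ * g.dist a b)) * P b))
    (hR : HasMajorant blk R (fun a b => θ * Real.exp (-(δ * g.dist a b)))) (hfix : T = T0 + R * T) :
    HasMajorantA blk adm T (fun a b => A * (1 - θ * c)⁻¹ * Real.exp (-((1 - α) * δ * g.dist a b)) * P b) := by
  intro y' μ B hμ x
  obtain ⟨E, hE, hEb⟩ := B6RandomWalk.exists_opBound T
  set q : ℝ := θ * c with hq
  have hq0 : 0 ≤ q := mul_nonneg hθ hc
  have hB : 0 ≤ B := hadm μ y' B hμ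
  set C : ℝ := A * (1 - q)⁻¹ * Real.exp (-((1 - α) * δ * g.dist (blk x) y')) * P y' * B with hC
  have hTμ : ∀ z, |T μ z| ≤ E * B := hEb μ B hB (hsup μ y' B hμ)
  have hN : ∀ N : ℕ, |T μ x| ≤ C + q ^ N * (E * B) := by
    intro N
    have hS := majorant_leftPartialSumA blk c δ α θ A P hA hP hθ hc hα0 hα1 hδ htri hdnn h261 hsmall hadm hT0 hR N y' μ B hμ x
    have hrem : |(R ^ N * T) μ x| ≤ q ^ N * (E * B) := by
      rw [Module.End.mul_apply]
      exact B6Prop26RightChainGeneric.sup_pow_le blk hθ hc hα1 hδ hdnn h261 hR N (T μ) (mul_nonneg hE hB) hTμ x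
    have hsplit : T μ x = (∑ n ∈ Finset.range N, R ^ n * T0) μ x + (R ^ N * T) μ x := by
      conv_lhs => rw [B6RandomWalkHom.leftFixedPoint_telescope hfix N]
      rfl
    rw [hsplit]
    refine (abs_add_le _ _).trans ?_
    have h1 : |(∑ n ∈ Finset.range N, R ^ n * T0) μ x| ≤ C := by simpa [hC, hq] using hS
    linarith [hrem, h1]
  have hlim : Filter.Tendsto (fun N : ℕ => C + q ^ N * (E * B)) Filter.atTop (nhds (C + 0 * (E * B))) :=
    ((tendsto_pow_atTop_nhds_zero_of_lt_one hq0 hsmall).mul_const (E * B)).const_add C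
  rw [zero_mul, add_zero] at hlim
  have := ge_of_tendsto' hlim hN
  simpa [hC, hq] using this

end LeftChain

end Literature.MathematicalPhysics.QuantumFieldTheory.Balaban1983to89.B6RandomWalkInputNormChain

end
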